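import Summits.QuantumFields.BalabanUV.T4Continuum.Support.ShellMeasureLandauEndFinal
import Summits.QuantumFields.BalabanUV.T4Continuum.Support.ShellMeasureWilsonRealizedSU2Words
import Literature.MathematicalPhysics.QuantumFieldTheory.Balaban1983to89.T4ExpWindowSmallField
import Literature.MathematicalPhysics.QuantumFieldTheory.Balaban1983to89.T4ReTrLipUnitary
import Literature.MathematicalPhysics.QuantumFieldTheory.Balaban1983to89.MissingProofs
import Literature.MathematicalPhysics.QuantumFieldTheory.Balaban1983to89.T4WilsonLinkAffine

/-!
# `T4Continuum.ShellMeasureLandauEndFinalToy` — row S88 «NON-VACUITY OF THE END-II-final OF RECORD»: the ONE-PLAQUETTE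
# `SU(2)` MODEL inhabits EVERY hypothesis of S76 f2 `ShellMeasureLandauEndFinal.slotAC_realized_su2_landauChart_final`
(cell `pub-balaban`, sub-cell `t4`, spine estimate NE7c (node U5b); NE7c ROUND-2 crew, unit
`b2b-balaban-t4-ne7c-formalise-leaf-04` gen 7 — row S88 of `t4/b2b-balaban-t4-ne7c-p1/LEAVES-NE7c-P1.md` (owner gen 32, l.18261
(c), motivated by F-ne7cleaf02g9-1 and crew rule G-1); ADDITIVE — imports S76 f2 `ShellMeasureLandauEndFinal` (p227065), the
level-0 dictionary `ShellMeasureWilsonRealizedSU2Words` (`gen`, `coe_chart`, `gen_mem_skewAdjoint`) and the tree's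
`T4ExpWindowSmallField` ∕ `T4ReTrLipUnitary` ∕ `MissingProofs` ∕ `T4WilsonLinkAffine` (`shift_ne_self`) ONLY; [folklore]; DATA `def`s (the toy's objects),
0 `def … : Prop`, 0 sorry, 0 citation)

HONEST FRAMING.  A TOY: a CONSISTENCY CERTIFICATE of the ≈ 75-binder hypothesis set of the live-level END-II-final of
record, nothing about Bałaban's minimiser, propagators or densities.  Finite four-torus programme, rung (B)+1 only — NOT
infinite volume, NOT a mass gap, NOT the Clay problem, NOT summit progress; NE7c (`T4IndicatorShell.ShellWeightBound`) NOT
PRINTED, NOT PROVED; «NE7c ⇐ the named binders» (c3); (M1) realized on a toy ≠ NE7c.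

THE MODEL (any `P : Params`, level `j`, positively oriented plaquette `p`; window `0 < S < 1∕6`).  Block `Λ = {b₁}`,
`b₁ = ⟨p.src, p.μ⟩` (`m₀ = 3` via any enumeration `e`); tree `T = ∅`; chart centre `c V ≡ (staple V p)⁻¹`,
`staple V p = V(b₂)V(b₃)⁻¹V(b₄)⁻¹` — EXTERIOR-DETERMINED AND GAUGE-COVARIANT (a constant centre, or one reading `V↾Λ`, is
incompatible with `hFsupp` for a gauge-invariant `F ≢ 0` on sections; this is the toy's image of «the tree-gauge pure
gauge of the block»), so the sectioned plaquette variable is `c·exp(ι x)·c⁻¹` (§1); density `F = 𝟙[dist1 U(∂p) ≤ 2 sin(S∕2)]`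
(measurable, GAUGE INVARIANT, `F(1) = 1 ≠ 0`) and tested variable `u = dist1 U(∂p)` (B14 (2.17)'s classifier letter for
ONE plaquette; measurable, gauge invariant, non-constant) (§2); scheme tuple on `ℂ^{m₀}`: `𝒢 = W𝒱 = Cf = ιs = Hop = 0`,
`H₁ = Φ = id` (`r_Φ = 1∕6`), so `Z_V(y) = y` (`solAt … = 0`, no Landau correction); `B₀ = 1`, `C₄ = C₂ = 0`,
`d_L = C₁ = B₃ = 1`, `ε₁ = 1∕12`, `ε₄ = 1∕6`, `a₃ = 2∕3`, `ε₃ = 1∕3`, `R_C = 1`; ONE read-out `ℓ Y = Σ_a Y_{e(b₁,a)}·τ_a`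
(`τ_a = quatMatrix (ι e_a)`, `‖τ_a‖ = 1`) with `ℓ (cplx x) = gen x` (level-0 dictionary), so `holOf [ℓ] Z x = exp (gen x)` IS
the sectioned plaquette variable and `hudict` holds with `classifier = u`; `κ_r = κ_c = 3`, `m = 1` (§3); `𝓔_W = 𝓔_E = 0`,
`Jco V = 𝟙_cube·(F ∘ section_V)` (centre-monotone by `dist1 (exp ι v) = 2|sin(‖v‖∕2)|`), `W V = cube`, `L = {ℓ}`,
`𝓡ℬ = readOutReal L`, `𝓡𝒵 = 𝓡𝒴′ = 𝓡𝒳 = ⊤`; `δ = ½`, `ρ = ¼`, `β = 0`, `η = z = c₁ = c₂ = 1` (letter size `κ_r z̄ = 1 = 1∕m`),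
`εθ = 144∕(r_Φ∕S − 1)²` ((SM) with equality) (§4).
CONCLUSION (§4 `slotAC_final_toy`): S76 f2 APPLIED BY NAME gives
`SlotAntiConcentration ((fieldMeasure P j SU2).withDensity F) u (εθ·1²) (1∕4) (2(m₀ + 0)∕(1 − ½))`; every binder is met by
explicit data, none is left as a hypothesis.  LIVENESS (§5 `toy_threshold_lt_window`): for `S ≤ 10⁻⁵`, `θ = εθ < 2 sin(S∕2)`,
so the shell `{¾θ ≤ u < θ}` lies where `F = 1` and is swept by chart points (`u ∘ section = 2|sin(‖x_{b₁}‖₂∕2)|`); its Haar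
mass is not computed here.  NOT HERE: anything about Bałaban's objects; the toy sits at unit `η` with `𝓔 = 0`, so S73's
`η²` bookkeeping, S74's square budget and the locality road are exercised through their binder SHAPES only.
HONEST DEPENDENCY (cell): continuum YM on T⁴ ⇐ BetaPertH ∧ nine spine estimates (0/9 proved); BetaPertH ⇐ (D1) ∧ (D4)
∧ CAP+tail; G-an2-4 gates asym, D1 and NE2/3/4.
-/

noncomputable section

open Set Metric NormedSpace MeasureTheory Function

namespace Summit.QuantumFields.BalabanUV.T4Continuum.ShellMeasureLandauEndFinalToy

open scoped ENNReal Matrix.Norms.L2Operator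
open Literature.MathematicalPhysics.QuantumLattice (quatMatrix)
open Literature.MathematicalPhysics.QuantumFieldTheory.Balaban1983to89
open B11Prop6Scheme (Prop4Hyp mapT)
open GaugeField (GaugeInvariant plaqHol gaugeAct)
open T4ShellMeasure (SlotAntiConcentration)
open T4CubePoincare (cube mem_cube_iff)
open T4CubeChartGnomonic (SU2)
open T4CubeChartExp (toE expPt expChart expFibreChart block_mem_cube toE_mem_ball_of_mem_cube)
open T4HaarSU2ExpChart (imQuat norm_imQuat)
open T4TreeGaugeFixing (NoClosedLoop fixTo noClosedLoop_empty fixTo_empty)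
open T4ExpWindowSmallField (dist1_expPt_eq dist1_eq_norm_coe_sub_one)
open T4ReTrLipUnitary (plaqHol_gaugeAct)
open T4QuatExpLog (norm_quatMatrix)
open ShellMeasureLevelAssembly (classifier)
open ShellMeasureWilsonWords (wordExp wordExp_cons wordExp_nil)
open ShellMeasureLandauHolonomy (solAt landauExp solAt_eq_of_unique)
open ShellMeasureLandauHolonomyChart (holOf cplx holOf_apply)
open ShellMeasureLandauHolonomySkew (readOutReal)
open ShellMeasureWilsonRealizedSU2 (M₂ gen coe_chart gen_mem_skewAdjoint)
open ShellMeasureLandauEndFinal (slotAC_realized_su2_landauChart_final)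

variable {P : Params} {j : ℕ}

/-! ## §1 The lattice data: one plaquette, its first bond, the staple, the covariant chart centre -/

/-- the first bond `⟨x, μ⟩` of the plaquette `p = ⟨x, μ, ν⟩` — the toy's block `Λ = {b₁}`. [folklore] -/
def b₁ (p : Plaq P j) : PBond P j := ⟨p.src, p.μ⟩

/-- the STAPLE of `p`: `V(x+e_μ, ν)·V(x+e_ν, μ)⁻¹·V(x, ν)⁻¹`, so that `V(∂p) = V(b₁)·staple V p`. [folklore] -/
def staple (V : GaugeField P j SU2) (p : Plaq P j) : SU2 :=
  V ⟨p.src.shift p.μ, p.ν⟩ * (V ⟨p.src.shift p.ν, p.μ⟩)⁻¹ * (V ⟨p.src, p.ν⟩)⁻¹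

/-- the toy's chart centre: the constant field `(staple V p)⁻¹` (only its value at `b₁` is read) — blind to `V↾{b₁}`
and gauge-covariant. [folklore] -/
def toyCentre (p : Plaq P j) (V : GaugeField P j SU2) : GaugeField P j SU2 := fun _ => (staple V p)⁻¹

/-- the sectioned plaquette variable: `(V[b₁ := w])(∂p) = w·staple V p`. [folklore] -/
theorem plaqHol_update [DecidableEq (PBond P j)] (V : GaugeField P j SU2) (p : Plaq P j) (w : ↥({b₁ p} : Finset (PBond P j)) → SU2) :
    plaqHol (updateFinset V {b₁ p} w) p = w ⟨b₁ p, Finset.mem_singleton_self _⟩ * staple V p := by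
  have hμν : p.ν ≠ p.μ := (ne_of_lt p.hμν).symm
  have hoff : ∀ b : PBond P j, b ≠ b₁ p → updateFinset V {b₁ p} w b = V b := fun b hb =>
    T4TiltOscillation.updateFinset_apply_of_not_mem V w (by rwa [Finset.mem_singleton])
  have e1 : plaqHol (updateFinset V {b₁ p} w) p = updateFinset V {b₁ p} w (b₁ p) *
      updateFinset V {b₁ p} w ⟨p.src.shift p.μ, p.ν⟩ * (updateFinset V {b₁ p} w ⟨p.src.shift p.ν, p.μ⟩)⁻¹ *
        (updateFinset V {b₁ p} w ⟨p.src, p.ν⟩)⁻¹ := rfl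
  rw [e1, T4TiltOscillation.updateFinset_apply_of_mem V w (Finset.mem_singleton_self (b₁ p)),
    hoff _ fun h => hμν (congrArg PBond.dir h), hoff _ fun h => T4WilsonLinkAffine.shift_ne_self p.src p.ν (congrArg PBond.src h),
    hoff _ fun h => hμν (congrArg PBond.dir h), staple]
  simp only [mul_assoc]

/-- … so `dist1 ((V[b₁ := w])(∂p)) = dist1 ((c V b₁)⁻¹·w)` for the covariant centre `c V b₁ = (staple V p)⁻¹`. [folklore] -/
theorem dist1_plaqHol_update [DecidableEq (PBond P j)] (V : GaugeField P j SU2) (p : Plaq P j) (w : ↥({b₁ p} : Finset (PBond P j)) → SU2) :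
    dist1 (plaqHol (updateFinset V {b₁ p} w) p) =
      dist1 (((toyCentre p V) (b₁ p))⁻¹ * w ⟨b₁ p, Finset.mem_singleton_self _⟩) := by
  rw [plaqHol_update, toyCentre, inv_inv]
  set y := w ⟨b₁ p, Finset.mem_singleton_self _⟩
  have h : staple V p * y = staple V p * (y * staple V p) * (staple V p)⁻¹ := by group
  rw [h, GaugeGroup.dist1_conj]

/-- … and on the exponential fibre chart about the covariant centre it is the chart letter's `dist1 (expPt x_{b₁})`. [folklore] -/
theorem dist1_plaqHol_section [DecidableEq (PBond P j)] (V : GaugeField P j SU2) (p : Plaq P j) {m₀ : ℕ}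
    (e : ↥({b₁ p} : Finset (PBond P j)) × Fin 3 ≃ Fin m₀) (x : Fin m₀ → ℝ) :
    dist1 (plaqHol (updateFinset V {b₁ p} (expFibreChart {b₁ p} (toyCentre p V) e x)) p) =
      dist1 (expPt fun i => x (e (⟨b₁ p, Finset.mem_singleton_self _⟩, i))) := by
  rw [dist1_plaqHol_update]
  unfold expFibreChart T4CubeChartExp.expChart
  rw [inv_mul_cancel_left]

/-! ## §2 The density, the tested variable, their measurability and gauge invariance -/

/-- the toy DENSITY: the small-plaquette window `𝟙[dist1 U(∂p) ≤ 2 sin(S∕2)]`. [folklore] -/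
def toyF (S : ℝ) (p : Plaq P j) (U : GaugeField P j SU2) : ℝ≥0∞ :=
  if dist1 (plaqHol U p) ≤ 2 * Real.sin (S / 2) then 1 else 0

/-- the toy TESTED VARIABLE: `u U = dist1 U(∂p)`. [folklore] -/
def toyU (p : Plaq P j) (U : GaugeField P j SU2) : ℝ := dist1 (plaqHol U p)

/-- `u` is measurable. [folklore] -/
theorem measurable_toyU (p : Plaq P j) : Measurable (toyU p) :=
  RegularGaugeGroup.measurable_dist1.comp (Missing.measurable_plaqHol p)

/-- `F` is measurable. [folklore] -/
theorem measurable_toyF (S : ℝ) (p : Plaq P j) : Measurable (toyF S p) :=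
  Measurable.ite (measurableSet_le (measurable_toyU p) measurable_const) measurable_const measurable_const

/-- `u` is gauge invariant (`U^g(∂p) = g(x)U(∂p)g(x)⁻¹`, `dist1` is conjugation invariant). [folklore] -/
theorem gaugeInvariant_toyU (p : Plaq P j) : GaugeInvariant (toyU p) := fun g U => by
  simp only [toyU, plaqHol_gaugeAct, GaugeGroup.dist1_conj]

/-- `F` is gauge invariant. [folklore] -/
theorem gaugeInvariant_toyF (S : ℝ) (p : Plaq P j) : GaugeInvariant (toyF S p) := fun g U => by
  simp only [toyF, plaqHol_gaugeAct, GaugeGroup.dist1_conj]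

/-- `F ≤ 1`. [folklore] -/
theorem toyF_le_one (S : ℝ) (p : Plaq P j) (U : GaugeField P j SU2) : toyF S p U ≤ 1 := by
  unfold toyF; split_ifs <;> simp

/-- `F` IS NON-ZERO: `F(1) = 1`. [folklore] -/
theorem toyF_one {S : ℝ} (hS : 0 ≤ S) (hSπ : S ≤ Real.pi) (p : Plaq P j) : toyF S p 1 = 1 := by
  have h0 : ∀ b, (1 : GaugeField P j SU2) b = 1 := fun _ => rfl
  have h1 : plaqHol (1 : GaugeField P j SU2) p = 1 := by simp [GaugeField.plaqHol, h0]
  have hsin : 0 ≤ Real.sin (S / 2) := Real.sin_nonneg_of_nonneg_of_le_pi (by linarith) (by linarith)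
  simp only [toyF, h1, GaugeGroup.dist1_one]
  rw [if_pos (by linarith)]

/-- the SUPPORT binder `hFsupp` (with `T = ∅`): a configuration in the window has its block variable within
`2 sin(S∕2)` of the covariant centre. [folklore] -/
theorem toyF_supp [DecidableEq (PBond P j)] (S : ℝ) (p : Plaq P j) (U₀ : GaugeField P j SU2) :
    ∀ (V : GaugeField P j SU2) (y : ↥({b₁ p} : Finset (PBond P j)) → SU2),
      toyF S p (fixTo ∅ U₀ (updateFinset V {b₁ p} y)) ≠ 0 →
        ∀ b (hb : b ∈ ({b₁ p} : Finset (PBond P j))), dist1 ((toyCentre p V b)⁻¹ * y ⟨b, hb⟩) ≤ 2 * Real.sin (S / 2) := by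
  intro V y hF b hb
  obtain rfl : b = b₁ p := Finset.mem_singleton.1 hb
  rw [fixTo_empty, toyF, dist1_plaqHol_update] at hF
  by_contra hlt
  exact hF (if_neg hlt)

/-! ## §3 The scheme side: the read-out, the trivial chain, the dictionary identities -/

/-- the `su(2)` generators as matrices: `τ_a = quatMatrix (ι e_a)`, `a = 0, 1, 2`. [folklore] -/
def tau (a : Fin 3) : M₂ := quatMatrix (imQuat (EuclideanSpace.single a (1 : ℝ)))

/-- `‖τ_a‖ = 1` (the quaternion model is an isometry). [folklore] -/
theorem norm_tau (a : Fin 3) : ‖tau a‖ = 1 := by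
  unfold tau
  rw [norm_quatMatrix, norm_imQuat, PiLp.norm_single, norm_one]

/-- the toy READ-OUT of the block bond: `ℓ Y = Σ_a Y_{e(b₁,a)} · τ_a`, a `ℂ`-linear map `ℂ^{m₀} → M₂(ℂ)`. [folklore] -/
def toyReadOut (p : Plaq P j) {m₀ : ℕ} (e : ↥({b₁ p} : Finset (PBond P j)) × Fin 3 ≃ Fin m₀) :
    (Fin m₀ → ℂ) →L[ℂ] M₂ :=
  ∑ a : Fin 3, (ContinuousLinearMap.proj (R := ℂ) (φ := fun _ : Fin m₀ => ℂ)
    (e (⟨b₁ p, Finset.mem_singleton_self _⟩, a))).smulRight (tau a)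

/-- `ℓ Y = Σ_a Y_{e(b₁,a)} · τ_a`. [folklore] -/
theorem toyReadOut_apply (p : Plaq P j) {m₀ : ℕ} (e : ↥({b₁ p} : Finset (PBond P j)) × Fin 3 ≃ Fin m₀)
    (Y : Fin m₀ → ℂ) :
    toyReadOut p e Y = ∑ a : Fin 3, Y (e (⟨b₁ p, Finset.mem_singleton_self _⟩, a)) • tau a := by
  simp [toyReadOut]

/-- `‖ℓ Y‖ ≤ 3‖Y‖` — the read-out constant `κ_r = κ_c = 3`. [folklore] -/
theorem norm_toyReadOut_le (p : Plaq P j) {m₀ : ℕ} (e : ↥({b₁ p} : Finset (PBond P j)) × Fin 3 ≃ Fin m₀)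
    (Y : Fin m₀ → ℂ) : ‖toyReadOut p e Y‖ ≤ 3 * ‖Y‖ := by
  rw [toyReadOut_apply]
  calc ‖∑ a : Fin 3, Y (e (⟨b₁ p, Finset.mem_singleton_self _⟩, a)) • tau a‖
      ≤ ∑ a : Fin 3, ‖Y (e (⟨b₁ p, Finset.mem_singleton_self _⟩, a)) • tau a‖ := norm_sum_le _ _
    _ ≤ ∑ _a : Fin 3, ‖Y‖ := Finset.sum_le_sum fun a _ => by
        rw [norm_smul, norm_tau, mul_one]; exact norm_le_pi_norm Y _
    _ = 3 * ‖Y‖ := by simp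

/-- THE DICTIONARY FOR THE READ-OUT: on a real point the read-out of `cplx x` IS the chart generator `gen x` of the
level-0 dictionary (`quatMatrix (ι x_{b₁})`). [folklore] -/
theorem toyReadOut_cplx (p : Plaq P j) {m₀ : ℕ} (e : ↥({b₁ p} : Finset (PBond P j)) × Fin 3 ≃ Fin m₀)
    (x : Fin m₀ → ℝ) :
    toyReadOut p e (cplx x) = gen {b₁ p} e ⟨b₁ p, Finset.mem_singleton_self _⟩ x := by
  rw [toyReadOut_apply]
  unfold gen tau cplx
  ext i j
  fin_cases i <;> fin_cases j <;>
    simp [Matrix.sum_apply, Fin.sum_univ_three, quatMatrix, T4HaarSU2ExpChart.imQuat_apply, Complex.ext_iff]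

/-- the trivial chain: with `𝒢 = 0`, `Λ = 0` the scheme map is `0`, so `solAt 0 0 W ε₄ J 𝔄 = 0` (`ε₄ ≥ 0`). [folklore] -/
theorem solAt_zero {𝒴 𝒵 : Type*} [NormedAddCommGroup 𝒴] [NormedSpace ℂ 𝒴] [NormedAddCommGroup 𝒵] [NormedSpace ℂ 𝒵]
    (W : 𝒴 → 𝒵) {ε₄ : ℝ} (hε₄ : 0 ≤ ε₄) (J : 𝒵) (𝔄 : 𝒴) :
    solAt (0 : 𝒵 →L[ℂ] 𝒴) (0 : 𝒴 →L[ℂ] 𝒴) W ε₄ J 𝔄 = 0 := by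
  have hT : ∀ X : 𝒴, mapT (0 : 𝒵 →L[ℂ] 𝒴) (0 : 𝒴 →L[ℂ] 𝒴) W J 𝔄 X = 0 := fun X => by
    simp [B11Prop6Scheme.mapT_apply]
  exact solAt_eq_of_unique (by rwa [norm_zero]) (hT 0) fun X' _ hX' => by rw [← hX', hT]

/-- no Landau correction: with `Hop = 0`, `landauExp C ι 0 r Y = Y`. [folklore] -/
theorem landauExp_zero {𝒴 𝒴' 𝒳 : Type*} [NormedAddCommGroup 𝒴] [NormedSpace ℂ 𝒴] [NormedAddCommGroup 𝒴']
    [NormedSpace ℂ 𝒴'] [NormedAddCommGroup 𝒳] [NormedSpace ℂ 𝒳] (C : 𝒴' → 𝒳) (ι : 𝒴 →L[ℂ] 𝒴') (r : ℝ) (Y : 𝒴) :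
    landauExp C ι (0 : 𝒳 →L[ℂ] 𝒴) r Y = Y := by
  simp [ShellMeasureLandauHolonomy.landauExp]

/-! ## §4 THE END APPLIED BY NAME TO THE TOY DATA -/

/-- the toy's chart factor: `Jco V x = 𝟙_cube(x) · F(section_V x)`. [folklore] -/
def toyJco [DecidableEq (PBond P j)] (S : ℝ) (p : Plaq P j) {m₀ : ℕ} (e : ↥({b₁ p} : Finset (PBond P j)) × Fin 3 ≃ Fin m₀)
    (V : GaugeField P j SU2) (x : Fin m₀ → ℝ) : ℝ≥0∞ :=
  (cube m₀ S).indicator (fun x => toyF S p (updateFinset V {b₁ p} (expFibreChart {b₁ p} (toyCentre p V) e x))) x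

/-- a contracted cube point stays in the cube. [folklore] -/
theorem smul_mem_cube {m₀ : ℕ} {S : ℝ} {x : Fin m₀ → ℝ} (hx : x ∈ cube m₀ S) {a : ℝ} (ha : 0 ≤ a) :
    Real.exp (-a) • x ∈ cube m₀ S := by
  rw [mem_cube_iff] at hx ⊢
  intro i
  rw [Pi.smul_apply, smul_eq_mul, abs_mul, abs_of_pos (Real.exp_pos _)]
  have h1 : Real.exp (-a) ≤ 1 := Real.exp_le_one_iff.2 (by linarith)
  nlinarith [hx i, abs_nonneg (x i), Real.exp_pos (-a)]

/-- CENTRE-MONOTONICITY on a section: `F(section x) ≤ F(section (e^{−a}x))` for a cube point `x`, `a ≥ 0`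
(`dist1 (exp ι v) = 2|sin(‖v‖₂∕2)|`, `‖v‖₂ < π` on the cube, `sin` monotone on `[0, π∕2]`). [folklore] -/
theorem toyF_section_mono [DecidableEq (PBond P j)] {S : ℝ} (hSπ : 3 * S ^ 2 < Real.pi ^ 2) (p : Plaq P j) {m₀ : ℕ}
    (e : ↥({b₁ p} : Finset (PBond P j)) × Fin 3 ≃ Fin m₀) (V : GaugeField P j SU2) {x : Fin m₀ → ℝ}
    (hx : x ∈ cube m₀ S) {a : ℝ} (ha : 0 ≤ a) :
    toyF S p (updateFinset V {b₁ p} (expFibreChart {b₁ p} (toyCentre p V) e x)) ≤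
      toyF S p (updateFinset V {b₁ p} (expFibreChart {b₁ p} (toyCentre p V) e (Real.exp (-a) • x))) := by
  unfold toyF
  rw [dist1_plaqHol_section, dist1_plaqHol_section, dist1_expPt_eq, dist1_expPt_eq]
  set v : Fin 3 → ℝ := fun i => x (e (⟨b₁ p, Finset.mem_singleton_self _⟩, i)) with hv
  have hv' : (fun i => (Real.exp (-a) • x) (e (⟨b₁ p, Finset.mem_singleton_self _⟩, i))) = Real.exp (-a) • v := by
    funext i; simp [hv]
  have hvπ : ‖toE v‖ < Real.pi := by
    simpa using toE_mem_ball_of_mem_cube hSπ (block_mem_cube e hx ⟨b₁ p, Finset.mem_singleton_self _⟩)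
  have hc1 : Real.exp (-a) ≤ 1 := Real.exp_le_one_iff.2 (by linarith)
  have hn : ‖toE (Real.exp (-a) • v)‖ = Real.exp (-a) * ‖toE v‖ := by
    rw [show toE (Real.exp (-a) • v) = Real.exp (-a) • toE v from rfl, norm_smul, Real.norm_of_nonneg (Real.exp_nonneg _)]
  have hle : Real.exp (-a) * ‖toE v‖ ≤ ‖toE v‖ := by nlinarith [norm_nonneg (toE v), Real.exp_pos (-a)]
  have hsin₁ : 0 ≤ Real.sin (‖toE v‖ / 2) := Real.sin_nonneg_of_nonneg_of_le_pi (by positivity) (by linarith [Real.pi_pos])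
  have hsin₂ : 0 ≤ Real.sin (Real.exp (-a) * ‖toE v‖ / 2) :=
    Real.sin_nonneg_of_nonneg_of_le_pi (by positivity) (by nlinarith [Real.pi_pos])
  have hpos : 0 ≤ Real.exp (-a) * ‖toE v‖ := by positivity
  have hmono : Real.sin (Real.exp (-a) * ‖toE v‖ / 2) ≤ Real.sin (‖toE v‖ / 2) :=
    Real.sin_le_sin_of_le_of_le_pi_div_two (by linarith [Real.pi_pos]) (by linarith) (by linarith)
  rw [hv', hn, abs_of_nonneg hsin₁, abs_of_nonneg hsin₂]
  by_cases h : 2 * Real.sin (‖toE v‖ / 2) ≤ 2 * Real.sin (S / 2)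
  · rw [if_pos h, if_pos (by linarith)]
  · rw [if_neg h]; exact bot_le

/-- the (SM) threshold of the toy: `εθ = 144∕(r_Φ∕S − 1)²` with `r_Φ = 1∕6`. [folklore] -/
def toyεθ (S : ℝ) : ℝ := 144 / ((1 / 6) / S - 1) ^ 2

/-- `0 < εθ` for `0 < S < 1∕6`. [folklore] -/
theorem toyεθ_pos {S : ℝ} (hS : 0 < S) (hS6 : S < 1 / 6) : 0 < toyεθ S := by
  have h : 1 < (1 / 6) / S := by rw [lt_div_iff₀ hS]; linarith
  unfold toyεθ
  positivity

/-- **ROW S88: THE END-II-final OF RECORD IS NOT VACUOUS.**  For every lattice `P`, level `j`, plaquette `p`, enumeration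
`e` of the `3` chart coordinates of the block `Λ = {b₁ p}` and window `0 < S < 1∕6`: S76 f2
`ShellMeasureLandauEndFinal.slotAC_realized_su2_landauChart_final` APPLIED BY NAME to the one-plaquette model of the header
(every binder met by explicit data of this file, none left as a hypothesis; `F ≠ 0` by `toyF_one`) yields (M1) for the toy
slot.  A consistency certificate; nothing about Bałaban's objects; NE7c NOT PROVED. [folklore] -/
theorem slotAC_final_toy [DecidableEq (PBond P j)] (p : Plaq P j) {m₀ : ℕ} (e : ↥({b₁ p} : Finset (PBond P j)) × Fin 3 ≃ Fin m₀)
    {S : ℝ} (hS : 0 < S) (hS6 : S < 1 / 6) :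
    SlotAntiConcentration ((fieldMeasure P j SU2).withDensity (toyF S p)) (toyU p) (toyεθ S * 1 ^ 2) (1 / 4)
      (2 * ((m₀ : ℝ) + (0 + 0)) / (1 - 1 / 2)) := by
  have hSπ : 3 * S ^ 2 < Real.pi ^ 2 := by nlinarith [Real.pi_gt_three]
  have hRad : (1 / 6 : ℝ) / S - 1 ≠ 0 := by
    have h : 1 < (1 / 6) / S := by rw [lt_div_iff₀ hS]; linarith
    linarith
  refine slotAC_realized_su2_landauChart_final (P := P) (j := j) (n := Fin 2)
    (𝒴 := Fin m₀ → ℂ) (𝒴' := Fin m₀ → ℂ) (𝒳 := Fin m₀ → ℂ) (𝒵 := Fin m₀ → ℂ) (ℬ := Fin m₀ → ℂ)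
    (T := ∅) noClosedLoop_empty 1 {b₁ p} e hS hSπ (toyCentre p) (measurable_toyF S p) (gaugeInvariant_toyF S p)
    (toyF_supp S p 1) (measurable_toyU p) (gaugeInvariant_toyU p) (ι := Unit) (Pu := {()})
    (Finset.singleton_nonempty ()) (fun _ => cube m₀ S) (toyJco S p e) (δ := 1 / 2) (ρ := 1 / 4) (β := 0)
    (fun _ => 0) (fun _ _ => 0) (B₀ := 1) (C₄ := 0) (a₃ := 2 / 3) (ε₄ := 1 / 6)
    (fun _ f => by simp) (fun _ => ⟨fun Y _ => by simp, differentiableOn_const _⟩) one_pos le_rfl (by norm_num)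
    (dL := 1) (C₁ := 1) (B₃ := 1) (ε₁ := 1 / 12) zero_le_one zero_le_one (by norm_num) le_rfl (by norm_num)
    (by norm_num) (by norm_num)
    (fun _ => ContinuousLinearMap.id ℂ (Fin m₀ → ℂ)) (fun _ B => by simp) (fun _ => id) (rΦ := 1 / 6)
    (fun _ => differentiableOn_id) (fun _ => rfl)
    (fun _ z hz => by rw [mem_ball_zero_iff] at hz; simp only [id]; linarith) (by linarith)
    (fun _ _ => 0) (C₂ := 0) (RC := 1) le_rfl (fun _ Z _ => by simp) (fun _ => differentiableOn_const _)
    (fun _ => 0) (fun _ Y => by simp) (fun _ => 0) (fun _ X => by simp) (ε₃ := 1 / 3) (by norm_num) (by norm_num)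
    (by norm_num) (fun _ => [toyReadOut p e]) (κr := 3) (by norm_num)
    (fun _ _ ℓ hℓ Y => by rw [List.mem_singleton.1 hℓ]; exact norm_toyReadOut_le p e Y) (m := 1)
    (fun _ _ => by simp) (κc := 3) (by norm_num)
    (fun _ _ Y => by simpa using norm_toyReadOut_le p e Y)
    (fun _ _ => 0) (fun _ _ => 0) (BW := 0) (BE := 0) (BElb := 0)
    (fun _ x _ c' _ _ => by simp) le_rfl (fun _ x _ c' _ _ => by simp) le_rfl (fun _ y _ => le_rfl)
    (fun _ y _ => by simp) {toyReadOut p e} ⊤ ⊤ ⊤ (by simp) (readOutReal {toyReadOut p e})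
    (fun _ f _ => by simp) (fun _ Y _ => AddSubgroup.mem_top _)
    (fun _ Y _ => AddSubgroup.mem_top _) (fun _ X _ => by simp)
    (fun _ Z _ => AddSubgroup.mem_top _) (fun _ B hB => by simpa using hB)
    (fun _ y _ => ?_) (fun V x hx => ?_) (fun V x _ => ?_)
    (fun V x hJ => ?_) (fun V x a ha => ?_) (fun V x => ?_) (fun _ => ShellMeasureLandauHolonomyPrint.chartCube_subset_closedBall hS.le)
    (by norm_num) (by norm_num) (by norm_num) (by norm_num) le_rfl (η := 1) (εθ := toyεθ S) (c₁ := 1) (c₂ := 1)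
    (z := 1) one_pos (toyεθ_pos hS hS6) (by norm_num) (by norm_num) (by norm_num) ?_
  · -- `hΦr`: the identity coarse field is real at real points — the read-out of `cplx y` is skew-Hermitian
    intro ℓ hℓ
    rw [Set.mem_singleton_iff.1 hℓ]
    show toyReadOut p e (cplx y) ∈ skewAdjoint M₂
    rw [toyReadOut_cplx]; exact gen_mem_skewAdjoint _ _ _ _
  · -- `hRdict`: `F(section x) = Jco V x · e^{−0}` on the cube
    rw [fixTo_empty, toyJco, indicator_of_mem hx]
    simp
  · -- `hudict`: THE DICTIONARY — `u ∘ section = ‖exp (gen x) − 1‖ = classifier` of the one-letter word `[ℓ (Z x)]`,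
    -- `Z x = cplx x` (trivial chain), `ℓ (cplx x) = gen x` (§3), `exp (gen x)` = the chart bond (level-0 `coe_chart`)
    have h1 : expFibreChart {b₁ p} (1 : GaugeField P j SU2) e x ⟨b₁ p, Finset.mem_singleton_self _⟩ =
        expPt (fun i => x (e (⟨b₁ p, Finset.mem_singleton_self _⟩, i))) :=
      show (1 : SU2) * _ = _ from one_mul _
    rw [fixTo_empty, toyU, dist1_plaqHol_section, dist1_eq_norm_coe_sub_one, ← h1, coe_chart]
    simp only [classifier, Finset.sup'_singleton, holOf_apply, List.map_cons, List.map_nil, wordExp_cons, wordExp_nil,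
      mul_one, landauExp_zero, solAt_zero _ (by norm_num : (0 : ℝ) ≤ 1 / 6), zero_add, ContinuousLinearMap.coe_id',
      id, toyReadOut_cplx]
  · -- `hJW`: `Jco` lives on the cube
    by_contra h
    exact hJ (indicator_of_notMem h _)
  · -- `hJ`: centre-monotone
    unfold toyJco
    by_cases hx : x ∈ cube m₀ S
    · rw [indicator_of_mem hx, indicator_of_mem (smul_mem_cube hx ha)]
      exact toyF_section_mono hSπ p e V hx ha
    · rw [indicator_of_notMem hx]; exact bot_le
  · -- `hJ1`
    unfold toyJco
    by_cases hx : x ∈ cube m₀ S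
    · rw [indicator_of_mem hx]; exact toyF_le_one S p _
    · rw [indicator_of_notMem hx]; exact bot_le
  · -- `hsm`: (SM) with equality at `εθ = 144∕(r_Φ∕S − 1)²`
    unfold toyεθ
    rw [show (36 : ℝ) * (1 * 1 + ((1 : ℕ) : ℝ) ^ 2 * 1 ^ 2 * 1 ^ 2) = 72 by norm_num,
      show (1 / 2 : ℝ) * (144 / ((1 / 6) / S - 1) ^ 2) = 72 / ((1 / 6) / S - 1) ^ 2 by ring]

/-! ## §5 Liveness: for a small window the threshold sits INSIDE the window -/

/-- for `0 < S ≤ 10⁻⁵` the toy's classifier threshold `θ = εθ·1²` is below the window radius `2 sin(S∕2)` of `F` (so the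
shell `{¾θ ≤ u < θ}` lies where `F = 1`; `u ∘ section = 2 sin(‖x‖₂∕2)` sweeps `[0, 2 sin(S∕2)]` on the cube). [folklore] -/
theorem toy_threshold_lt_window {S : ℝ} (hS : 0 < S) (hS4 : S ≤ 1 / 100000) :
    toyεθ S * 1 ^ 2 < 2 * Real.sin (S / 2) := by
  -- Jordan: `sin (S∕2) ≥ (2∕π)(S∕2) ≥ S∕4`
  have hj : S / 4 ≤ Real.sin (S / 2) := by
    have h := Real.mul_le_sin (by linarith : 0 ≤ S / 2) (by linarith [Real.pi_gt_three] : S / 2 ≤ Real.pi / 2)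
    have : S / 4 ≤ 2 / Real.pi * (S / 2) := by
      rw [div_mul_eq_mul_div, le_div_iff₀ Real.pi_pos]; nlinarith [Real.pi_le_four]
    linarith
  have hR : 1 / (12 * S) ≤ 1 / (6 * S) - 1 := by
    rw [div_sub_one (by positivity), div_le_div_iff₀ (by positivity) (by positivity)]; nlinarith
  have h1 : toyεθ S ≤ 144 / (1 / (12 * S)) ^ 2 := by
    rw [toyεθ, show (1 / 6 : ℝ) / S = 1 / (6 * S) by rw [div_div]]
    exact div_le_div_of_nonneg_left (by norm_num) (by positivity) (pow_le_pow_left₀ (by positivity) hR 2)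
  have h2 : (144 : ℝ) / (1 / (12 * S)) ^ 2 = 20736 * S ^ 2 := by field_simp; ring
  have h3 : 20736 * S ^ 2 ≤ 20736 * S * (1 / 100000) := by nlinarith
  rw [one_pow, mul_one]
  linarith

end Summit.QuantumFields.BalabanUV.T4Continuum.ShellMeasureLandauEndFinalToy

end
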